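import Summits.HodgeConjecture.HodgeConjecture.Theorems.F0P3LettersXiLocalPacketUnitary   -- ★ (F0P3-p01 (g8)): `XiLocalPacketUnitary`, `hFinU_of_xiLocalPacketUnitary` (+ ★ `F0P3XiSideOfRecord`: `xiSideOfRecord`; ★ `xiEvpOfRecord`, `ramOfRecord₂`, `xiPacketFamilyOfRecord`, row #21 `xiUnram_xiEvpOfRecord`)
import HarnessLib

/-!
# Crux `H413`, ROAD «K9-∞» — THE ENDOSCOPIC ANCHOR: `OverrideWitness.anchorG ∕ anchorH` AT THE ENDOSCOPIC PACKETS `Π(ξ)`, `ρ(ξ) = ξ`, from the ξ-side of record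

Cell `hodgecm-mathlib`, F0∕P3a, crux H413 (`stmt-HodgeConjecture-24833`); F0P3a-p01 (g11) on LEAD F0P3a-plan (g8) WORD T7-9 (Q2 «=») after the census
`F0/P3a/F0P3a-p01/g11/CENSUS-K9-0a-b-EndoscopicData.F0P3a-p01g11.md` (K9-0a(b): the endoscopic DATA of record are already ★ — `xiEvpOfRecord`, `ramOfRecord₂` — so no
definition is filed; this is the one honest ξ-indexed THEOREM next to them).  PROOF lane: theorems only; no `def`, no instance, no notation, no named fact, no `sorry`;
`--supports stmt-HodgeConjecture-24833`.  Count-neutral.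

THE FIELD IT PAYS.  The rung-0 closer's `OverrideWitness` (`Cruxes/H413/Lines/F0_U3LettersRung1.lean` §B) carries, inside the ONE ∃ of `stub_K9`, the PACKET ANCHORS
`anchorG : ∀ Q v, v ∉ S₀ → v ∉ ramG Q → ∃ π : IrrClass (G′_v), π.IsAdmissible ∧ π.IsUnitarizable ∧ π.IsSphericalWith K_v (νG v) (evpG Q v)` (and `anchorH` likewise):
off the level and the packet's ramification, the packet e.v.p. IS the eigencharacter of an admissible UNITARIZABLE `K_v`-spherical class [Rogawski1990 §13.7 p. 210;
§12.2 (2) pp. 173–174; §13.1 p. 199].  For the ENDOSCOPIC packets `Q = Π(ξ)`, `ρ = ξ` — the only packets the ξ-side of record names — this is a THEOREM of the tree: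
* `anchorXi_of_xiLocalPacketUnitary` (§1): off `ram₀ ξ := ramOfRecord₂ … ξ (hexc ξ)` and for a Haar family `μv`, the member `πⁿ(ξ_v)` of the packet of record
  (★ `xiPacketFamilyOfRecord … ξ v`) is admissible, `K_v`-spherical WITH the ξ-side e.v.p. of record `tXi₀ ξ v := xiEvpOfRecord … μv ξ v` (★ row #21
  `xiUnram_xiEvpOfRecord`) and UNITARIZABLE (★ `hFinU_of_xiLocalPacketUnitary`, from the letter «XiLocalPacketUnitary», a HYPOTHESIS `hXU` here — on the registry it is the
  closed stub `stub_XLPU`, itself modulo the theta letter); the same read through the bundle `ξd₀ := xiSideOfRecord …` (`anchorXi_xiSideOfRecord`);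
* `anchorG_at_PiXi` ∕ `anchorH_at_ρXi` (§2): the PACKET-TYPE-PARAMETRIC corollary — for ANY packet types `PG PH` and ANY (J2) data `evpG evpH ramG ramH PiXi ρXi` whose
  endoscopic values agree with the ξ-side of record off the packet's ramification (`hE : v ∉ ramG (PiXi ξ) → evpG (PiXi ξ) v = ξd₀.tXi ξ v`, `hR : ξd₀.ram ξ ⊆ ramG (PiXi ξ)`;
  resp. `H`), the text of `OverrideWitness.anchorG` (resp. `anchorH`) holds AT `Q = PiXi ξ` (resp. `ρ = ρXi ξ`) token for token (the level guard `v ∉ S₀` is not even needed).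
HONEST VALUE: this pays the anchors on the endoscopic image of `PiXi ∕ ρXi` only; at the STABLE packets (`Q ∉ range PiXi`) the anchors remain print [§13.7 p. 210: the
members of a global packet are unitary and almost everywhere unramified] inside the full-spectrum letter «K9-STF» (F0P3-plan desk 2026-08-31T23:53:32Z (ii)).

References: [Rogawski1990] §12.2 (1)–(2) pp. 173–174, §13.1 p. 199, §13.7 p. 210, §14.6 Thm. 14.6.1 p. 241; [CartierCorvallis1979] §IV.1 Cor. 4.1–4.2; [Langlands1980] p. 209.
HC_CM is proved only modulo the printed citations until rung 0 closes.
-/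

set_option autoImplicit false
set_option linter.dupNamespace false

noncomputable section

open NumberField IsDedekindDomain MeasureTheory
open Literature.NumberTheory.Rogawski1990 Literature.NumberTheory.GaloisRepresentations
open Literature.NumberTheory.Automorphic Literature.NumberTheory.Automorphic.UnitaryGroup
open scoped Matrix

namespace Summit.HodgeConjecture.HodgeConjecture.Cruxes.H413.F0P3Rung0EndoscopicAnchor

open Summit.HodgeConjecture.HodgeConjecture.Cruxes.H413.F0P3InnerFormClassificationV6
open Summit.HodgeConjecture.HodgeConjecture.Cruxes.H413.F0P3XiPacketFamilyOfRecord
open Summit.HodgeConjecture.HodgeConjecture.Cruxes.H413.F0P3XiSideOfRecord (xiSideOfRecord)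
open Summit.HodgeConjecture.HodgeConjecture.Cruxes.H413.F0P3LettersXiLocalPacketUnitary (XiLocalPacketUnitary hFinU_of_xiLocalPacketUnitary)

variable (L : Type) [Field L] [NumberField L] [IsCMField L] (H : Matrix (Fin 3) (Fin 3) L)
  (hH : (H.map (cmConjRingHom L))ᵀ = H) (hHd : IsUnit H.det) (μω : HeckeCharacter L) (hμu : μω.IsUnitary)
  [∀ v : HeightOneSpectrum (𝓞 ↥(maximalRealSubfield L)), MeasurableSpace (Gqs L v ⧸ Subgroup.center (Gqs L v))]
  (μZ : ∀ v : HeightOneSpectrum (𝓞 ↥(maximalRealSubfield L)), Measure (Gqs L v ⧸ Subgroup.center (Gqs L v)))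
  (keys : ∀ (ξ : OneDimAutRepH L) (v : HeightOneSpectrum (𝓞 ↥(maximalRealSubfield L))),
    (∀ w : PlacesOver L v, IsCMField.complexConj L • w.1 = w.1) →
      {p : IrrClass (Gqs L v) × IrrClass (Gqs L v) //
        KeysCaseTwoLabels L v (μω.semilocalComponent L v) (torusLocalComponent L (IsCMField.complexConj L) v ξ.η)
          (torusLocalComponent L (IsCMField.complexConj L) v ξ.ψ) p.1 p.2 ∧
        p.1.IsSquareIntegrable (μZ v) ∧ ¬ p.2.IsSquareIntegrable (μZ v)})
  [∀ v : HeightOneSpectrum (𝓞 ↥(maximalRealSubfield L)),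
    MeasurableSpace ((cmDatum L 2 (Matrix.of fun i j : Fin 2 => if i.val + j.val + 1 = 2 then (1 : L) else 0)).Local v ×
      (cmDatum L 1 (Matrix.of fun i j : Fin 1 => if i.val + j.val + 1 = 1 then (1 : L) else 0)).Local v)]
  [∀ (v : HeightOneSpectrum (𝓞 ↥(maximalRealSubfield L)))
      (a : ((cmDatum L 2 (Matrix.of fun i j : Fin 2 => if i.val + j.val + 1 = 2 then (1 : L) else 0)).Local v ×
        (cmDatum L 1 (Matrix.of fun i j : Fin 1 => if i.val + j.val + 1 = 1 then (1 : L) else 0)).Local v)),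
    MeasurableSpace (((cmDatum L 2 (Matrix.of fun i j : Fin 2 => if i.val + j.val + 1 = 2 then (1 : L) else 0)).Local v ×
        (cmDatum L 1 (Matrix.of fun i j : Fin 1 => if i.val + j.val + 1 = 1 then (1 : L) else 0)).Local v) ⧸
      Subgroup.centralizer ({a} : Set ((cmDatum L 2 (Matrix.of fun i j : Fin 2 => if i.val + j.val + 1 = 2 then (1 : L) else 0)).Local v ×
        (cmDatum L 1 (Matrix.of fun i j : Fin 1 => if i.val + j.val + 1 = 1 then (1 : L) else 0)).Local v)))]
  [∀ (v : HeightOneSpectrum (𝓞 ↥(maximalRealSubfield L))) (γ : (cmDatum L 3 H).Local v),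
    MeasurableSpace ((cmDatum L 3 H).Local v ⧸ Subgroup.centralizer ({γ} : Set ((cmDatum L 3 H).Local v)))]
  (Δ : ∀ v : HeightOneSpectrum (𝓞 ↥(maximalRealSubfield L)), LocalTransferFactor L H v)
  (mH : ∀ v : HeightOneSpectrum (𝓞 ↥(maximalRealSubfield L)),
    OrbitalMeasureFamily ((cmDatum L 2 (Matrix.of fun i j : Fin 2 => if i.val + j.val + 1 = 2 then (1 : L) else 0)).Local v ×
      (cmDatum L 1 (Matrix.of fun i j : Fin 1 => if i.val + j.val + 1 = 1 then (1 : L) else 0)).Local v))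
  (mG : ∀ v : HeightOneSpectrum (𝓞 ↥(maximalRealSubfield L)), letI : MeasurableSpace ((cmDatum L 3 H).Local v) := borel _; OrbitalMeasureFamily ((cmDatum L 3 H).Local v))
  (νG : ∀ v : HeightOneSpectrum (𝓞 ↥(maximalRealSubfield L)), @Measure ((cmDatum L 3 H).Local v) (borel _))
  (νH : ∀ v : HeightOneSpectrum (𝓞 ↥(maximalRealSubfield L)),
    Measure ((cmDatum L 2 (Matrix.of fun i j : Fin 2 => if i.val + j.val + 1 = 2 then (1 : L) else 0)).Local v ×
      (cmDatum L 1 (Matrix.of fun i j : Fin 1 => if i.val + j.val + 1 = 1 then (1 : L) else 0)).Local v))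
  (ξloc : OneDimAutRepH L → ∀ v : HeightOneSpectrum (𝓞 ↥(maximalRealSubfield L)),
    (cmDatum L 2 (Matrix.of fun i j : Fin 2 => if i.val + j.val + 1 = 2 then (1 : L) else 0)).Local v ×
      (cmDatum L 1 (Matrix.of fun i j : Fin 1 => if i.val + j.val + 1 = 1 then (1 : L) else 0)).Local v →* ℂˣ)
  (hCM : letI : ∀ v : HeightOneSpectrum (𝓞 ↥(maximalRealSubfield L)), MeasurableSpace ((cmDatum L 3 H).Local v) := fun _ => borel _
    ∀ (ξ : OneDimAutRepH L) (v : HeightOneSpectrum (𝓞 ↥(maximalRealSubfield L)))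
    (hns : ∀ w : PlacesOver L v, IsCMField.complexConj L • w.1 = w.1)
    (T : GL (Fin 3) (LocalRing L v)) (a : LocalRing L v) (ha : IsUnit a)
    (h : formCongr (conjLocal L (IsCMField.complexConj L) v) T (H.map (algebraMap L (LocalRing L v))) =
      a • (Matrix.of fun i j : Fin 3 => if i.val + j.val + 1 = 3 then (1 : L) else 0).map (algebraMap L (LocalRing L v)))
    (π2 πn : IrrClass (Gqs L v)),
    KeysCaseTwoLabels L v (μω.semilocalComponent L v) (torusLocalComponent L (IsCMField.complexConj L) v ξ.η)
      (torusLocalComponent L (IsCMField.complexConj L) v ξ.ψ) π2 πn → ¬ πn.IsSquareIntegrable (μZ v) →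
    CMNonsplitCharIdentityAt L v H (Δ v) (mH v) (mG v) (νG v) (νH v) (ξloc ξ v) (IrrClass.comap (cmDatumLocalCongr L v T ha h).symm πn))
  (hexc : ∀ ξ : OneDimAutRepH L, ∀ᶠ v : HeightOneSpectrum (𝓞 ↥(maximalRealSubfield L)) in Filter.cofinite,
      ∀ hns : ∀ w : PlacesOver L v, IsCMField.complexConj L • w.1 = w.1,
        ((keys ξ v hns).1.2).IsSpherical (cmLocalIntegralLevel L 3 (qsForm L) v))
  (μv : ∀ v : Places L, @Measure ((cmDatum L 3 H).Local v) (borel _))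

/-! ## §1 The anchor at `ξ`: `πⁿ(ξ_v)` of record is admissible, unitarizable and `K_v`-spherical with the ξ-side e.v.p. of record -/

/-- **THE ENDOSCOPIC ANCHOR** (from the letter «XiLocalPacketUnitary» and row #21): off `ram₀ ξ = ramOfRecord₂ … ξ (hexc ξ)`, for a Haar family `μv` on the `G′_v`
(Borel σ-algebras), there is an admissible UNITARIZABLE class of `G′_v` that is `K_v`-spherical with eigencharacter `tXi₀ ξ v = xiEvpOfRecord … μv ξ v` — namely the
member `πⁿ(ξ_v)` of the packet of record. [cite: Rogawski1990, §12.2 (1)–(2) pp. 173–174; §13.1 p. 199; §13.7 p. 210] [cite: CartierCorvallis1979, §IV.1 Cor. 4.1] -/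
theorem anchorXi_of_xiLocalPacketUnitary (hXU : XiLocalPacketUnitary L H hH hHd μω hμu μZ keys)
    (hμv : ∀ v : Places L, letI : MeasurableSpace ((cmDatum L 3 H).Local v) := borel _; (μv v).IsHaarMeasure)
    (ξ : OneDimAutRepH L) (v : Places L) (hv : v ∉ ramOfRecord₂ L H hH hHd μω μZ keys ξ (hexc ξ)) :
    letI : MeasurableSpace ((cmDatum L 3 H).Local v) := borel _
    ∃ π : IrrClass ((cmDatum L 3 H).Local v), π.IsAdmissible ∧ π.IsUnitarizable ∧
      π.IsSphericalWith (cmLocalIntegralLevel L 3 H v) (μv v)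
        ((letI : ∀ v : HeightOneSpectrum (𝓞 ↥(maximalRealSubfield L)), MeasurableSpace ((cmDatum L 3 H).Local v) := fun _ => borel _
          xiEvpOfRecord L H hH hHd μω hμu Δ mH mG νG νH ξloc μZ keys hCM μv) ξ v) := by
  letI : ∀ v : HeightOneSpectrum (𝓞 ↥(maximalRealSubfield L)), MeasurableSpace ((cmDatum L 3 H).Local v) := fun _ => borel _
  haveI : BorelSpace ((cmDatum L 3 H).Local v) := ⟨rfl⟩
  haveI : (μv v).IsHaarMeasure := hμv v
  obtain ⟨hsph, hadm⟩ := xiUnram_xiEvpOfRecord L H hH hHd μω hμu Δ mH mG νG νH ξloc μZ keys hCM μv ξ v hv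
  exact ⟨_, hadm, (hFinU_of_xiLocalPacketUnitary L H hH hHd μω hμu μZ keys Δ mH mG νG νH ξloc hCM hXU ξ v).1, hsph⟩

section Bundle

variable {PG PH : Type} (evpG : PG → EvpData L H) (evpH : PH → EvpData L H) (ramG : PG → Finset (Places L)) (ramH : PH → Finset (Places L))
  (PiXi : OneDimAutRepH L → PG) (ρXi : OneDimAutRepH L → PH)

/-- **The anchor at `ξ`, read through the ξ-side of record `ξd₀ := xiSideOfRecord …`** (its `ram ∕ tXi ∕ packFin` are `ramOfRecord₂ ∕ xiEvpOfRecord ∕ xiPacketFamilyOfRecord`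
by `rfl`): off `ξd₀.ram ξ`, the class `(ξd₀.packFin ξ v).πn` is admissible, unitarizable and `K_v`-spherical with `ξd₀.tXi ξ v`.
[cite: Rogawski1990, §12.2 (1)–(2) pp. 173–174; §13.1 p. 199; §13.7 p. 210] [cite: CartierCorvallis1979, §IV.1 Cor. 4.1] -/
theorem anchorXi_xiSideOfRecord (hXU : XiLocalPacketUnitary L H hH hHd μω hμu μZ keys)
    (hμv : ∀ v : Places L, letI : MeasurableSpace ((cmDatum L 3 H).Local v) := borel _; (μv v).IsHaarMeasure)
    (ξ : OneDimAutRepH L) (v : Places L)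
    (hv : v ∉ (xiSideOfRecord L H hH hHd μω hμu Δ mH mG νG νH ξloc μZ keys hCM hexc μv evpG evpH ramG ramH PiXi ρXi).ram ξ) :
    letI : MeasurableSpace ((cmDatum L 3 H).Local v) := borel _
    ((xiSideOfRecord L H hH hHd μω hμu Δ mH mG νG νH ξloc μZ keys hCM hexc μv evpG evpH ramG ramH PiXi ρXi).packFin ξ v).πn.IsAdmissible ∧
      ((xiSideOfRecord L H hH hHd μω hμu Δ mH mG νG νH ξloc μZ keys hCM hexc μv evpG evpH ramG ramH PiXi ρXi).packFin ξ v).πn.IsUnitarizable ∧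
      ((xiSideOfRecord L H hH hHd μω hμu Δ mH mG νG νH ξloc μZ keys hCM hexc μv evpG evpH ramG ramH PiXi ρXi).packFin ξ v).πn.IsSphericalWith
        (cmLocalIntegralLevel L 3 H v) (μv v)
        ((xiSideOfRecord L H hH hHd μω hμu Δ mH mG νG νH ξloc μZ keys hCM hexc μv evpG evpH ramG ramH PiXi ρXi).tXi ξ v) := by
  letI : ∀ v : HeightOneSpectrum (𝓞 ↥(maximalRealSubfield L)), MeasurableSpace ((cmDatum L 3 H).Local v) := fun _ => borel _
  haveI : BorelSpace ((cmDatum L 3 H).Local v) := ⟨rfl⟩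
  haveI : (μv v).IsHaarMeasure := hμv v
  obtain ⟨hsph, hadm⟩ := xiUnram_xiEvpOfRecord L H hH hHd μω hμu Δ mH mG νG νH ξloc μZ keys hCM μv ξ (hexc := hexc ξ) v hv
  exact ⟨hadm, (hFinU_of_xiLocalPacketUnitary L H hH hHd μω hμu μZ keys Δ mH mG νG νH ξloc hCM hXU ξ v).1, hsph⟩

/-! ## §2 The packet-type-parametric corollary: `OverrideWitness.anchorG ∕ anchorH` AT `Q = Π(ξ)`, `ρ = ρ(ξ)` -/

/-- **`anchorG` AT THE ENDOSCOPIC PACKET `Π(ξ)`** — for ANY packet type `PG` and ANY (J2) data `(evpG, ramG, PiXi)` whose values at `Π(ξ)` agree with the ξ-side of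
record off the packet's ramification (`hE`) and whose ramification contains `ram₀ ξ` (`hR`): off `ramG (Π(ξ))` the e.v.p. `evpG (Π(ξ)) v` is the eigencharacter of an
admissible unitarizable `K_v`-spherical class of `G′_v` — the text of the closer's `OverrideWitness.anchorG` at `Q = PiXi ξ` (its level guard `v ∉ S₀` is not needed).
[cite: Rogawski1990, §13.7 p. 210; §12.2 (2) pp. 173–174; §13.1 p. 199] [cite: CartierCorvallis1979, §IV.1 Cor. 4.1–4.2] -/
theorem anchorG_at_PiXi (hXU : XiLocalPacketUnitary L H hH hHd μω hμu μZ keys)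
    (hμv : ∀ v : Places L, letI : MeasurableSpace ((cmDatum L 3 H).Local v) := borel _; (μv v).IsHaarMeasure)
    (hE : ∀ (ξ : OneDimAutRepH L) (v : Places L), v ∉ ramG (PiXi ξ) →
      evpG (PiXi ξ) v = (xiSideOfRecord L H hH hHd μω hμu Δ mH mG νG νH ξloc μZ keys hCM hexc μv evpG evpH ramG ramH PiXi ρXi).tXi ξ v)
    (hR : ∀ ξ : OneDimAutRepH L, (xiSideOfRecord L H hH hHd μω hμu Δ mH mG νG νH ξloc μZ keys hCM hexc μv evpG evpH ramG ramH PiXi ρXi).ram ξ ⊆ ramG (PiXi ξ))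
    (ξ : OneDimAutRepH L) (v : Places L) (hv : v ∉ ramG (PiXi ξ)) :
    letI : MeasurableSpace ((cmDatum L 3 H).Local v) := borel _
    ∃ π : IrrClass ((cmDatum L 3 H).Local v), π.IsAdmissible ∧ π.IsUnitarizable ∧
      π.IsSphericalWith (cmLocalIntegralLevel L 3 H v) (μv v) (evpG (PiXi ξ) v) := by
  rw [hE ξ v hv]
  exact ⟨_, anchorXi_xiSideOfRecord L H hH hHd μω hμu μZ keys Δ mH mG νG νH ξloc hCM hexc μv evpG evpH ramG ramH PiXi ρXi hXU hμv ξ v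
    (fun h => hv (hR ξ h))⟩

/-- **`anchorH` AT THE ENDOSCOPIC PACKET `ρ(ξ) = ξ`** — the `H`-side twin: for ANY `PH` and ANY `(evpH, ramH, ρXi)` with `evpH (ρ(ξ)) v = tXi₀ ξ v` off `ramH (ρ(ξ)) ⊇ ram₀ ξ`,
the transported packet e.v.p. `evpH (ρ(ξ)) v` is the eigencharacter of an admissible unitarizable `K_v`-spherical class of `G′_v` — the text of `OverrideWitness.anchorH`
at `ρ = ρXi ξ`. [cite: Rogawski1990, §13.7 p. 210; §13.1 Prop. 13.1.3 p. 199; §4.13 Lemma 4.13.1] [cite: CartierCorvallis1979, §IV.1 Cor. 4.1–4.2] -/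
theorem anchorH_at_ρXi (hXU : XiLocalPacketUnitary L H hH hHd μω hμu μZ keys)
    (hμv : ∀ v : Places L, letI : MeasurableSpace ((cmDatum L 3 H).Local v) := borel _; (μv v).IsHaarMeasure)
    (hE : ∀ (ξ : OneDimAutRepH L) (v : Places L), v ∉ ramH (ρXi ξ) →
      evpH (ρXi ξ) v = (xiSideOfRecord L H hH hHd μω hμu Δ mH mG νG νH ξloc μZ keys hCM hexc μv evpG evpH ramG ramH PiXi ρXi).tXi ξ v)
    (hR : ∀ ξ : OneDimAutRepH L, (xiSideOfRecord L H hH hHd μω hμu Δ mH mG νG νH ξloc μZ keys hCM hexc μv evpG evpH ramG ramH PiXi ρXi).ram ξ ⊆ ramH (ρXi ξ))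
    (ξ : OneDimAutRepH L) (v : Places L) (hv : v ∉ ramH (ρXi ξ)) :
    letI : MeasurableSpace ((cmDatum L 3 H).Local v) := borel _
    ∃ π : IrrClass ((cmDatum L 3 H).Local v), π.IsAdmissible ∧ π.IsUnitarizable ∧
      π.IsSphericalWith (cmLocalIntegralLevel L 3 H v) (μv v) (evpH (ρXi ξ) v) := by
  rw [hE ξ v hv]
  exact ⟨_, anchorXi_xiSideOfRecord L H hH hHd μω hμu μZ keys Δ mH mG νG νH ξloc hCM hexc μv evpG evpH ramG ramH PiXi ρXi hXU hμv ξ v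
    (fun h => hv (hR ξ h))⟩

end Bundle

end Summit.HodgeConjecture.HodgeConjecture.Cruxes.H413.F0P3Rung0EndoscopicAnchor

end
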